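import Literature.AnabelianGeometry.AbsoluteAnabelian.AbsTopILem27iiiStepOfSigmaStarProofs
import Literature.AnabelianGeometry.AbsoluteAnabelian.AbsTopILem27iiiBridges
import Literature.AnabelianGeometry.AbsoluteAnabelian.ProfiniteCompletionPi
import Literature.AnabelianGeometry.AbsoluteAnabelian.ProfiniteRankProofs
import HarnessLib

/-!
# [AbsTopI] Thm 2.6 (iii) and Thm 2.6 (v) (general form) from (∗)_Σ — corollaries by name

S. Mochizuki, *Topics in Absolute Anabelian Geometry I: Generalities* (2012) [AbsTopI], Thm 2.6 (iii)
and (v), manuscript p. 22.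

PROOF-ONLY file (no definitions, no named facts) of the abc-iut row «HOOK-FROM-SIGMA-STAR» (seat
abc-iut-w6-d074; abc-iut-L4-lead RULING #8j (6)): the Lemma 2.7 (iii) step being DERIVED from (∗)_Σ
(`FundamentalExtension.lem27iiiStep_of_sigmaStarCondition`), abc-iut-w6-d073's bridges
(`AbsTopILem27iiiBridges.lean`) and abc-iut-w6-d034's hook closers give, for every extension with MLF
base data that splits over an open subgroup of `G`, with `Δ` topologically finitely generated
([AbsTopI] Prop 2.2) and pro-`Σ`, `Π` topologically finitely generated (Thm 2.6 (ii) clause one) and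
(∗)_Σ:
* `thm26iii_of_sigmaStarCondition` — the typed [AbsTopI] Thm 2.6 (iii) (`E.Thm26iii S`, BOTH clauses)
  and `thm26iii_open_of_sigmaStarCondition` (at every open `H ⊆ Π`);
* `MLFBase.thm26vFull_of_sigmaStarCondition` — the typed general-`Θ` [AbsTopI] Thm 2.6 (v)
  (`E.Thm26vFull B`) for EVERY `Σ ⊆ Primes`, in particular in the regime `Σ = Primes` of [IUTchI–III];
* `MLFBase.thm26vFull_of_starCondition_of_splits`, `thm26iii_primes_of_starCondition` — the same at
  `Σ = Primes` from print's (∗) ([AbsAnab] Lemma 1.1.4 (ii)), via abc-iut-w5-d188's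
  `starCondition_iff_sigmaStarCondition_primes`.
So the three [AbsTopI] §2 nodes Thm 2.6 (ii), (iii), (v) now rest on ONE input set
⟨MLF base, Prop 2.2, `Δ` pro-`Σ`, splitting, (∗)_Σ⟩ — no Lemma 2.7 (iii) fact.
HONEST FRAMING: refereed, undisputed paper; (∗)_Σ / the splitting are hypotheses on data (their
geometric origin — Tate modules of the Albanese, a rational point — is not formalised); nothing here
bears on [IUTchIII] Cor. 3.12; typed ≠ proved elsewhere.
-/

noncomputable section

namespace Literature.AnabelianGeometry.AbsoluteAnabelian

namespace FundamentalExtension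

variable {E : FundamentalExtension.{0}}

/-- **[AbsTopI] Thm 2.6 (iii) AS TYPED (`E.Thm26iii S`, both clauses) from (∗)_Σ** — for an extension
with MLF base data, `Π` topologically finitely generated (Thm 2.6 (ii) clause one), `Δ` topologically
finitely generated (Prop 2.2) and pro-`Σ`, split over an open subgroup of `G`, satisfying (∗)_Σ.  No
Lemma 2.7 (iii) input remains. [cite: MochizukiAbsTopI2012, Thm 2.6 (iii) p.22] -/
theorem thm26iii_of_sigmaStarCondition (B : E.MLFBase) {S : Set ℕ} (hΔ : E.GeomTFG)
    (htfg : IsTopologicallyFinitelyGenerated E.arith) (hΔS : IsProSet E.geom S)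
    (hs : E.SplitsOverOpenSubgroup) (hstar : E.SigmaStarCondition S) : E.Thm26iii S :=
  thm26iii_of_lem27iiiStep B htfg hΔS (lem27iiiStep_of_sigmaStarCondition B hΔ hs hstar)

/-- The same with "`Π` tfg" replaced by "`G` tfg" ([NSW] 7.5.10 for `G_k`; Thm 2.6 (ii) clause one is
then `IsTopologicallyFinitelyGenerated.of_extension`). [cite: MochizukiAbsTopI2012, Thm 2.6 (iii) p.22] -/
theorem thm26iii_of_sigmaStarCondition_of_geomTFG (B : E.MLFBase) {S : Set ℕ} (hΔ : E.GeomTFG)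
    (hG : IsTopologicallyFinitelyGenerated E.gal) (hΔS : IsProSet E.geom S)
    (hs : E.SplitsOverOpenSubgroup) (hstar : E.SigmaStarCondition S) : E.Thm26iii S :=
  thm26iii_of_sigmaStarCondition B hΔ
    (IsTopologicallyFinitelyGenerated.of_extension E.aug E.aug_surjective hΔ hG) hΔS hs hstar

/-- **Thm 2.6 (iii) for every open `H ⊆ Π` from (∗)_Σ** (both clauses, the shape consumed by the
Thm 2.6 (v) closers). [cite: MochizukiAbsTopI2012, Thm 2.6 (iii) p.22] -/
theorem thm26iii_open_of_sigmaStarCondition (B : E.MLFBase) {S : Set ℕ} (hΔ : E.GeomTFG)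
    (htfg : IsTopologicallyFinitelyGenerated E.arith) (hΔS : IsProSet E.geom S)
    (hs : E.SplitsOverOpenSubgroup) (hstar : E.SigmaStarCondition S) :
    ∀ (H : Subgroup E.arith), IsOpen (H : Set E.arith) →
      thetaSet ↥H 2 ⊆ {l ∈ S | l.Prime} ∧
        (2 ≤ (thetaSet ↥H 1).encard → thetaSet ↥H 2 = {l ∈ S | l.Prime}) :=
  thm26iii_open_of_lem27iiiStep B htfg hΔS (lem27iiiStep_of_sigmaStarCondition B hΔ hs hstar)

/-- **[AbsTopI] Thm 2.6 (v), GENERAL form (`Θ ⊆ Π`, `ζ̃`), for EVERY `Σ ⊆ Primes`, from (∗)_Σ** —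
`E.Thm26vFull B` for an extension with MLF base data, `Δ` tfg (Prop 2.2) and pro-`Σ`, `Π` tfg, split
over an open subgroup of `G`, satisfying (∗)_Σ: the rank identity of (ii) per open `Π′` is
abc-iut-w6-d074 g2's `exists_freeProlRank_open_eq_add_of_sigmaStar`, the Lemma 2.7 (iii) step is
`lem27iiiStep_of_sigmaStarCondition`; assembled by abc-iut-w6-d034's hook closer.  This covers the
regime `Σ = Primes` of [IUTchI–III] left open by `MLFBase.thm26vFull_of_exists_prime_not_mem`.
[cite: MochizukiAbsTopI2012, Thm 2.6 (v) p.22] -/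
theorem MLFBase.thm26vFull_of_sigmaStarCondition (B : E.MLFBase) (S : Set ℕ)
    (hS : S ⊆ {q | q.Prime}) (hΔ : E.GeomTFG) (htfg : IsTopologicallyFinitelyGenerated E.arith)
    (hΔS : IsProSet E.geom S) (hs : E.SplitsOverOpenSubgroup) (hstar : E.SigmaStarCondition S) :
    E.Thm26vFull B :=
  MLFBase.thm26vFull_of_lem27iiiStep B S hS hΔ htfg hΔS
    (fun hall P hP => by
      obtain ⟨m, hm, -⟩ := E.exists_freeProlRank_open_eq_add_of_sigmaStar hs hstar P hP
      exact ⟨m, fun l _ => hm l (hall l Fact.out)⟩)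
    (lem27iiiStep_of_sigmaStarCondition B hΔ hs hstar)

/-- **[AbsTopI] Thm 2.6 (v), general form, in the regime `Σ = Primes` of [IUTchI–III], from print's
(∗)** ([AbsAnab] Lemma 1.1.4 (ii) hypotheses: MLF base, splitting, `Δ` tfg, (∗); plus `Π` tfg): (∗) is
(∗)_Σ at `Σ = Primes` (abc-iut-w5-d188's `starCondition_iff_sigmaStarCondition_primes`).
[cite: MochizukiAbsTopI2012, Thm 2.6 (v) p.22] -/
theorem MLFBase.thm26vFull_of_starCondition_of_splits (B : E.MLFBase) (hs : E.SplitsOverOpenSubgroup)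
    (hΔ : E.GeomTFG) (hstar : E.StarCondition) (htfg : IsTopologicallyFinitelyGenerated E.arith) :
    E.Thm26vFull B :=
  MLFBase.thm26vFull_of_starCondition_of_lem27iiiStep B hs hΔ hstar htfg
    (lem27iiiStep_of_sigmaStarCondition B hΔ hs
      (E.starCondition_iff_sigmaStarCondition_primes.1 hstar))

/-- **[AbsTopI] Thm 2.6 (iii) at `Σ = Primes` from print's (∗)** (clause one vacuous, clause two
from `lem27iiiStep_of_sigmaStarCondition`). [cite: MochizukiAbsTopI2012, Thm 2.6 (iii) p.22] -/
theorem thm26iii_primes_of_starCondition (B : E.MLFBase) (hΔ : E.GeomTFG)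
    (htfg : IsTopologicallyFinitelyGenerated E.arith) (hs : E.SplitsOverOpenSubgroup)
    (hstar : E.StarCondition) : E.Thm26iii {q | q.Prime} :=
  thm26iii_of_sigmaStarCondition B hΔ htfg ⟨fun _ _ _ _ hq _ => hq⟩ hs
    (E.starCondition_iff_sigmaStarCondition_primes.1 hstar)

end FundamentalExtension

end Literature.AnabelianGeometry.AbsoluteAnabelian
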